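import Mathlib
import Literature.RingTheory.TwoVariableSeries.Basic
import Summits.ResolutionOfSingularities.ResolutionOfSingularities.Theorems.WeightedInvariantLocalWeightedDropMonicDescentPrepInvariance

/-!
# `WeightedInvariant.LocalWeightedDrop`, sub-stub N4″: ONE VERTEX DISSOLUTION and its effect on the Newton set (piece T-1′, steps (d1)–(d2))

Crux item stmt-ResolutionOfSingularities-8899 `LocalWeightedDrop` (route `ResolutionOfSingularities/WeightedInvariant`), door
`WeightedConstruction` stmt-ResolutionOfSingularities-0571.  [OURS · L1 W4.3, chain w43, lead prover; first file of piece T-1′ (`stub_monicDescentPrep`: well-preparing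
re-centrings exist) of `N4PRIME-PLAN.md` §10.  MODEL: Hironaka's vertex preparation (Cossart–Jannsen–Saito LNM 2270 Ch. 8, "dissolving a solvable vertex").]

For a pair `(A₀, A₁)` over a field of characteristic 2 and a point `P = 2e` with `coeff P A₀ = s²` and `coeff e A₁ = 0` (a SOLVABLE point), the re-centring
`z = y + s·u^e` replaces `A₀` by `B₀ = A₀ + A₁·(s u^e) + s² u^{2e}`:
* `coeff_dissolveFst` — the coefficient formula; `coeff_dissolveFst_self` — the point `P` disappears;
* `mem_newtonSet_dissolve` — every NEW Newton point is a midpoint `a + e` of an `A₁`-point `2a` and `P`;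
* `weight_dissolve_ge` — for every weight, the minimum over the Newton set does not drop; `weight_dissolve_gt` — if `P` was the unique `w`-minimum, all
  points of the new Newton set are strictly `w`-above `P`; `uniqueMin_dissolve` — any OTHER unique `w′`-minimum `P′` persists, with its `A₀`-coefficient,
  as the unique `w′`-minimum; `lowerBound_dissolve` — strict lower weight bounds persist.
-/

set_option linter.dupNamespace false -- mandated namespace of this single-conjunct summit

noncomputable section

namespace Summit.ResolutionOfSingularities.ResolutionOfSingularities.Theorems

namespace MonicDescent

open MvPowerSeries Literature.RingTheory.TwoVariableSeries

variable {k : Type} [Field k]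

/-- The first component after dissolving with `s·u^e`: `A₀ + A₁·(s u^e) + (s u^e)²`. -/
def dissolveFst (A₀ A₁ : MvPowerSeries (Fin 2) k) (e : Fin 2 →₀ ℕ) (s : k) : MvPowerSeries (Fin 2) k :=
  A₀ + A₁ * monomial e s + monomial e s ^ 2

/-- `dissolveFst` is the first component of `recentre (s u^e)`. -/
theorem recentre_monomial_fst (A₀ A₁ : MvPowerSeries (Fin 2) k) (e : Fin 2 →₀ ℕ) (s : k) :
    (recentre (monomial e s) A₀ A₁).1 = dissolveFst A₀ A₁ e s := rfl

/-- COEFFICIENT FORMULA. -/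
theorem coeff_dissolveFst (A₀ A₁ : MvPowerSeries (Fin 2) k) (e : Fin 2 →₀ ℕ) (s : k) (d : Fin 2 →₀ ℕ) :
    coeff d (dissolveFst A₀ A₁ e s) =
      coeff d A₀ + (if e ≤ d then coeff (d - e) A₁ * s else 0) + (if d = 2 • e then s ^ 2 else 0) := by
  unfold dissolveFst
  rw [map_add, map_add, coeff_mul_monomial, pow_two, monomial_mul_monomial, coeff_monomial, two_nsmul, ← pow_two]

/-- Coefficients can change only at `P = 2e` and at the midpoints `a + e`, `coeff a A₁ ≠ 0`. -/
theorem coeff_dissolveFst_eq_of_not {A₀ A₁ : MvPowerSeries (Fin 2) k} {e : Fin 2 →₀ ℕ} {s : k} {d : Fin 2 →₀ ℕ}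
    (hP : d ≠ 2 • e) (hmid : ∀ a : Fin 2 →₀ ℕ, coeff a A₁ ≠ 0 → d ≠ a + e) :
    coeff d (dissolveFst A₀ A₁ e s) = coeff d A₀ := by
  rw [coeff_dissolveFst, if_neg hP, add_zero]
  by_cases hle : e ≤ d
  · rw [if_pos hle]
    by_cases ha : coeff (d - e) A₁ = 0
    · rw [ha, zero_mul, add_zero]
    · exact absurd (by
        refine finsupp_fin2_ext ?_ ?_ <;>
        · simp only [Finsupp.add_apply, Finsupp.tsub_apply]; have := hle; have h0 := this 0; have h1 := this 1; omega) (hmid (d - e) ha)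
  · rw [if_neg hle, add_zero]

/-- THE SOLVABLE POINT DISAPPEARS (char 2): if `coeff (2e) A₀ = s²` and `coeff e A₁ = 0` then `coeff (2e) B₀ = 0`. -/
theorem coeff_dissolveFst_self [CharP k 2] {A₀ A₁ : MvPowerSeries (Fin 2) k} {e : Fin 2 →₀ ℕ} {s : k}
    (hs : coeff (2 • e) A₀ = s ^ 2) (hA1 : coeff e A₁ = 0) : coeff (2 • e) (dissolveFst A₀ A₁ e s) = 0 := by
  rw [coeff_dissolveFst, if_pos rfl, hs]
  have hsub : (2 • e - e : Fin 2 →₀ ℕ) = e := by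
    refine finsupp_fin2_ext ?_ ?_ <;> simp [two_nsmul]
  have hmid : (if e ≤ 2 • e then coeff (2 • e - e) A₁ * s else 0) = 0 := by
    split_ifs
    · rw [hsub, hA1, zero_mul]
    · rfl
  rw [hmid, add_zero]
  have h2 : (2 : k) = 0 := by
    have h := CharP.cast_eq_zero k 2
    simpa using h
  linear_combination s ^ 2 * h2

/-- NEW NEWTON POINTS ARE MIDPOINTS: a point of the new Newton set is an old point, or `a + e` with `2a` an (old and new) `A₁`-point. -/
theorem mem_newtonSet_dissolve {A₀ A₁ : MvPowerSeries (Fin 2) k} {e : Fin 2 →₀ ℕ} {s : k} {Q : Fin 2 →₀ ℕ}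
    (hQ : Q ∈ newtonSet (dissolveFst A₀ A₁ e s) A₁) (hQP : Q ≠ 2 • e) :
    Q ∈ newtonSet A₀ A₁ ∨ ∃ a : Fin 2 →₀ ℕ, coeff a A₁ ≠ 0 ∧ Q = a + e := by
  rcases hQ with hQ | ⟨a, rfl, ha⟩
  · change coeff Q (dissolveFst A₀ A₁ e s) ≠ 0 at hQ
    by_cases hmid : ∃ a : Fin 2 →₀ ℕ, coeff a A₁ ≠ 0 ∧ Q = a + e
    · exact Or.inr hmid
    · push Not at hmid
      left
      rw [coeff_dissolveFst_eq_of_not hQP hmid] at hQ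
      exact Or.inl hQ
  · exact Or.inl (Or.inr ⟨a, rfl, ha⟩)

/-- Weight of a midpoint: `2·w(a + e) = w(2a) + w(2e)`. -/
theorem two_mul_weight_midpoint (w : Fin 2 → ℕ) (a e : Fin 2 →₀ ℕ) :
    2 * Finsupp.weight w (a + e) = Finsupp.weight w (2 • a) + Finsupp.weight w (2 • e) := by
  simp only [map_add, map_nsmul, smul_eq_mul]
  ring

/-- WEIGHT MONOTONICITY: every point of the new Newton set is `w`-above some point of the old one. -/
theorem weight_dissolve_ge {A₀ A₁ : MvPowerSeries (Fin 2) k} {e : Fin 2 →₀ ℕ} {s : k} (hP : 2 • e ∈ newtonSet A₀ A₁) (w : Fin 2 → ℕ)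
    {Q : Fin 2 →₀ ℕ} (hQ : Q ∈ newtonSet (dissolveFst A₀ A₁ e s) A₁) :
    ∃ Q' ∈ newtonSet A₀ A₁, Finsupp.weight w Q' ≤ Finsupp.weight w Q := by
  by_cases hQP : Q = 2 • e
  · exact ⟨2 • e, hP, by rw [hQP]⟩
  rcases mem_newtonSet_dissolve hQ hQP with hQ' | ⟨a, ha, rfl⟩
  · exact ⟨Q, hQ', le_rfl⟩
  · have h2 := two_mul_weight_midpoint w a e
    rcases le_total (Finsupp.weight w (2 • a)) (Finsupp.weight w (2 • e)) with h | h
    · exact ⟨2 • a, Or.inr ⟨a, rfl, ha⟩, by omega⟩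
    · exact ⟨2 • e, hP, by omega⟩

/-- STRICT LOWER BOUNDS PERSIST: if every old point is strictly `w`-above level `L`, so is every new point. -/
theorem lowerBound_dissolve {A₀ A₁ : MvPowerSeries (Fin 2) k} {e : Fin 2 →₀ ℕ} {s : k} (hP : 2 • e ∈ newtonSet A₀ A₁) (w : Fin 2 → ℕ) {L : ℕ}
    (hL : ∀ Q ∈ newtonSet A₀ A₁, L < Finsupp.weight w Q) :
    ∀ Q ∈ newtonSet (dissolveFst A₀ A₁ e s) A₁, L < Finsupp.weight w Q := by
  intro Q hQ
  obtain ⟨Q', hQ', hle⟩ := weight_dissolve_ge hP w hQ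
  exact lt_of_lt_of_le (hL Q' hQ') hle

/-- THE DISSOLVED VERTEX IS LEFT STRICTLY BELOW: if `P = 2e` was the unique `w`-minimum of the old Newton set (and is solvable: `coeff P A₀ = s²`,
`coeff e A₁ = 0`, char 2), then every point of the new Newton set is strictly `w`-above `P`. -/
theorem weight_dissolve_gt [CharP k 2] {A₀ A₁ : MvPowerSeries (Fin 2) k} {e : Fin 2 →₀ ℕ} {s : k}
    (hs : coeff (2 • e) A₀ = s ^ 2) (hA1 : coeff e A₁ = 0) (w : Fin 2 → ℕ)
    (hmin : ∀ Q ∈ newtonSet A₀ A₁, Q ≠ 2 • e → Finsupp.weight w (2 • e) < Finsupp.weight w Q) :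
    ∀ Q ∈ newtonSet (dissolveFst A₀ A₁ e s) A₁, Finsupp.weight w (2 • e) < Finsupp.weight w Q := by
  intro Q hQ
  have hQP : Q ≠ 2 • e := by
    rintro rfl
    rcases hQ with hQ | ⟨a, ha2, ha⟩
    · exact hQ (coeff_dissolveFst_self hs hA1)
    · have : a = e := by
        refine finsupp_fin2_ext ?_ ?_ <;>
        · have h0 := congrArg (fun f : Fin 2 →₀ ℕ => f 0) ha2
          have h1 := congrArg (fun f : Fin 2 →₀ ℕ => f 1) ha2
          simp only [Finsupp.smul_apply, smul_eq_mul] at h0 h1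
          omega
      rw [this] at ha
      exact ha hA1
  rcases mem_newtonSet_dissolve hQ hQP with hQ' | ⟨a, ha, rfl⟩
  · exact hmin Q hQ' hQP
  · have h2 := two_mul_weight_midpoint w a e
    have ha2 : 2 • a ≠ 2 • e := by
      intro h
      have : a = e := by
        refine finsupp_fin2_ext ?_ ?_ <;>
        · have h0 := congrArg (fun f : Fin 2 →₀ ℕ => f 0) h
          have h1 := congrArg (fun f : Fin 2 →₀ ℕ => f 1) h
          simp only [Finsupp.smul_apply, smul_eq_mul] at h0 h1
          omega
      rw [this] at ha; exact ha hA1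
    have := hmin (2 • a) (Or.inr ⟨a, rfl, ha⟩) ha2
    omega

/-- OTHER UNIQUE MINIMA PERSIST: if `P′ ≠ 2e` is the unique `w`-minimum of the old Newton set then its `A₀`-coefficient is unchanged, it lies in the new
Newton set and is its unique `w`-minimum. -/
theorem uniqueMin_dissolve {A₀ A₁ : MvPowerSeries (Fin 2) k} {e : Fin 2 →₀ ℕ} {s : k} (hP : 2 • e ∈ newtonSet A₀ A₁) (w : Fin 2 → ℕ)
    {P' : Fin 2 →₀ ℕ} (hP' : P' ∈ newtonSet A₀ A₁) (hne : P' ≠ 2 • e)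
    (hmin : ∀ Q ∈ newtonSet A₀ A₁, Q ≠ P' → Finsupp.weight w P' < Finsupp.weight w Q) :
    coeff P' (dissolveFst A₀ A₁ e s) = coeff P' A₀ ∧ P' ∈ newtonSet (dissolveFst A₀ A₁ e s) A₁ ∧
      ∀ Q ∈ newtonSet (dissolveFst A₀ A₁ e s) A₁, Q ≠ P' → Finsupp.weight w P' < Finsupp.weight w Q := by
  -- `P′` is not a midpoint `a + e` (that would put it `w`-between `2a` and `2e`, both other points)
  have hmid : ∀ a : Fin 2 →₀ ℕ, coeff a A₁ ≠ 0 → P' ≠ a + e := by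
    intro a ha hPa
    have h2 := two_mul_weight_midpoint w a e
    have hPlt : Finsupp.weight w P' < Finsupp.weight w (2 • e) := hmin _ hP (Ne.symm hne)
    have ha2 : 2 • a ≠ P' := by
      intro h
      -- then `2a = a + e`, so `a = e` and `P′ = 2e`
      apply hne
      rw [← h]
      have : a = e := by
        refine finsupp_fin2_ext ?_ ?_ <;>
        · have h0 := congrArg (fun f : Fin 2 →₀ ℕ => f 0) (h.trans hPa)
          have h1 := congrArg (fun f : Fin 2 →₀ ℕ => f 1) (h.trans hPa)
          simp only [Finsupp.smul_apply, smul_eq_mul, Finsupp.add_apply] at h0 h1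
          omega
      rw [this]
    have halt : Finsupp.weight w P' < Finsupp.weight w (2 • a) := hmin _ (Or.inr ⟨a, rfl, ha⟩) ha2
    rw [hPa] at hPlt halt
    omega
  have hcoef : coeff P' (dissolveFst A₀ A₁ e s) = coeff P' A₀ := coeff_dissolveFst_eq_of_not hne hmid
  refine ⟨hcoef, ?_, ?_⟩
  · rcases hP' with hP' | ⟨a, rfl, ha⟩
    · left; change coeff P' (dissolveFst A₀ A₁ e s) ≠ 0; rw [hcoef]; exact hP'
    · exact Or.inr ⟨a, rfl, ha⟩
  · intro Q hQ hQne
    by_cases hQP : Q = 2 • e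
    · rw [hQP]; exact hmin _ hP (Ne.symm hne)
    rcases mem_newtonSet_dissolve hQ hQP with hQ' | ⟨a, ha, rfl⟩
    · exact hmin Q hQ' hQne
    · have h2 := two_mul_weight_midpoint w a e
      have hPe : Finsupp.weight w P' < Finsupp.weight w (2 • e) := hmin _ hP (Ne.symm hne)
      have hPa : Finsupp.weight w P' ≤ Finsupp.weight w (2 • a) := by
        by_cases h : 2 • a = P'
        · rw [h]
        · exact (hmin _ (Or.inr ⟨a, rfl, ha⟩) h).le
      omega

end MonicDescent

end Summit.ResolutionOfSingularities.ResolutionOfSingularities.Theorems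

end
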